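import Mathlib
import Literature.NumberTheory.LFunctions.Zhang2022.Section4Lemma46Rouche
import Literature.NumberTheory.LFunctions.Zhang2022.Section4RoucheLattice
import HarnessLib

/-!
# Zhang (2022), §4 p. 23, Lemma 4.7 — "`𝒜(ρ+w,ψ)` has exactly three zeros inside
# `|w| = α(1+c′α𝓛)`" from (4.12), kernel-checked MODULO the exact-count form of Rouché's theorem
# (FACT F-29, hypothesis form)

Topic `Literature/NumberTheory/LFunctions/Zhang2022` (Landau–Siegel audit tree; verdict-neutral).
Y. Zhang, *Discrete mean estimates and the Landau–Siegel zero*, arXiv:2211.02515v1 (2022)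
[Zhang2022LandauSiegel] — **an unrefereed manuscript under adjudication**; the nodes below are the
campaign's CLAIM nodes (`SkeletonPartOne`, `TypedSection04C`), stated not asserted. DAG nodes
`Z22:Lem4.7` + `Z22:Lem4.7.pf` [Z22 p.23, tex L1266–L1276]:

> Lemma 4.7. Suppose `ρ = 1/2 + iγ` is a zero of `𝒜(s,ψ)` satisfying `|γ − 2πt₀| < 𝓛₁ + 2`. Then
> the function `𝒜(ρ+w,ψ)` has exactly three zeros inside the circle `|w| = α(1 + c′α𝓛)`, counted
> with multiplicity. Proof. In a way similar to the proof of Lemma 4.6 […] the functions `𝒜(ρ+w,ψ)`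
> and `1 − P^{−2w}` have the same number of zeros inside this circle, while the later has exactly
> three zeros inside the same circle which are at `w = 0`, `w = iα` and `w = −iα`. □

The banked node `Skeleton.Lemma47 c′` types this as three DISTINCT zeros (`Set.ncard = 3`). Route
(rigorous version of "in a way similar", needing neither the outer circle nor the simplicity
half of Lemma 4.6, whose typed height window / `σ`-range would not cover the two outer zeros):
Rouché (exact-count form — FACT F-29, now the tree THEOREM
`Rouche.finsum_analyticOrderNatAt_eq_of_norm_sub_lt`; kept as a binder `hRouche` in the `_of_rouche`
versions) on the THREE SMALL circles `|w − ikα| = α(1−c′α𝓛)`, `k ∈ {−1,0,1}` (inside `|w| < 2α`;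
there `|1 − P^{−2w}| > 6c′α𝓛` by (4.13) and the period `iα`, and `|𝒜(ρ+w) − (1−P^{−2w})| ≤ Cα𝓛`
by (4.12) = node `Eq412`) gives one simple zero per small disc; the lattice lemma of
`Section4RoucheLattice` puts every zero with `|w| < α(1+c′α𝓛)` in a small disc and the three zeros
inside `|w| < α(1+2C⁺α𝓛)`: the zero set is `{0, iα+v₁, −iα+v₋₁}`, `|v_{±1}| < c′α²𝓛`
(`three_zeros_of_rouche`), whence `lemma47_of_rouche`; the binder is discharged in
`Section4Prop22iiiRouche` (`lemma46_of`, `three_zeros_of`, `lemma47_of`, `prop22iii_of`).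

What is NOT asserted: Lemma 4.2, (4.12) (CLAIM nodes); hence not Lemmas 4.6/4.7 as such. Nothing
about Theorems 1–2 of the source is stated or implied; nothing here bears on the verdict on (8.24).

## References

* Y. Zhang, arXiv:2211.02515v1 (2022), §4 p. 23, Lemma 4.7 and its proof; (4.12), (4.13) p. 22.
  [cite: Zhang2022LandauSiegel, §4 Lemma 4.7]
* J. B. Conway, *Functions of One Complex Variable* (1973), Ch. V §3, Theorem 3.8 (Rouché) —
  FACT F-29 of the campaign FACT-LIST (hypothesis form). [cite: Zhang2022LandauSiegel, §4 p. 23]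
-/

noncomputable section

open Complex Real Set Filter Topology

namespace Literature.NumberTheory.LFunctions.Zhang2022.Section4

open Literature.NumberTheory.LFunctions.Zhang2022.Skeleton

variable {D : ℕ}

/-! ## The pieces of the proof, for a fixed zero `ρ` (explicit hypotheses, no thresholds) -/

section Pieces

variable [NeZero D] (χ : DirichletCharacter ℂ D) (x : Chr D) (ρ : ℂ)

/-- **Rouché on the small circle `|w − ikα| = r`, `|k| ≤ 1`** ("in a way similar to the proof of
Lemma 4.6"): with `𝒜(ρ+·)` holomorphic on `|w| < 2α`, `|𝒜(ρ+w) − (1−P^{−2w})| ≤ η` there ((4.12)),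
`|1 − P^{−2z}| > η` on `|z| = r < α` ((4.13); the same on the shifted circles by periodicity), and
the zero set `{0}` of `1 − P^{−2w}` in `|w| < r`, the count form of Rouché (`hRouche`, **FACT F-29,
hypothesis form**) gives exactly one zero of `𝒜(ρ+·)` in the disc `|w − ikα| < r`.
[cite: Zhang2022LandauSiegel, §4 Lemma 4.7 (proof)] -/
theorem small_disc_unique_zero
    (hRouche : ∀ (f g : ℂ → ℂ) (c : ℂ) (r : ℝ), 0 < r →
      (∃ U : Set ℂ, IsOpen U ∧ Metric.closedBall c r ⊆ U ∧ DifferentiableOn ℂ f U ∧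
        DifferentiableOn ℂ g U) →
      (∀ z ∈ Metric.sphere c r, ‖f z - g z‖ < ‖g z‖) →
      ∑ᶠ z ∈ Metric.ball c r, analyticOrderNatAt f z =
        ∑ᶠ z ∈ Metric.ball c r, analyticOrderNatAt g z)
    {r η : ℝ} (hℓ0 : 0 < ell D) (hD2 : 2 ≤ D) (hα : 0 < alpha D) (hr0 : 0 < r)
    (hrα : r < alpha D)
    (hA : DifferentiableOn ℂ (fun w : ℂ => calA χ x (ρ + w)) (Metric.ball 0 (2 * alpha D)))
    (E412 : ∀ w : ℂ, ‖w‖ < 2 * alpha D → ‖calA χ x (ρ + w) - (1 - Pm2w D w)‖ ≤ η)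
    (hbig : ∀ z : ℂ, ‖z‖ = r → η < ‖1 - Pm2w D z‖)
    (eone : {w : ℂ | ‖w‖ < r ∧ 1 - Pm2w D w = 0} = {0}) {k : ℤ} (hk : |k| ≤ 1) :
    ∃ v : ℂ, {v' : ℂ | ‖v'‖ < r ∧ calA χ x (ρ + ((k : ℂ) * I * (alpha D : ℂ) + v')) = 0} = {v} := by
  have hPer : ∀ w : ℂ, Pm2w D ((k : ℂ) * I * (alpha D : ℂ) + w) = Pm2w D w :=
    fun w => Pm2w_add_int_mul hℓ0 k w
  have hk' : |(k : ℝ)| ≤ 1 := by exact_mod_cast hk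
  have hpk : ‖(k : ℂ) * I * (alpha D : ℂ)‖ ≤ alpha D := by
    rw [norm_int_mul_I_mul_alpha hα.le]; nlinarith
  -- the shifted functions are holomorphic on `|v| < α`
  have hfk : DifferentiableOn ℂ
      (fun v : ℂ => calA χ x (ρ + ((k : ℂ) * I * (alpha D : ℂ) + v))) (Metric.ball 0 (alpha D)) := by
    have hmaps : Set.MapsTo (fun v : ℂ => (k : ℂ) * I * (alpha D : ℂ) + v)
        (Metric.ball 0 (alpha D)) (Metric.ball 0 (2 * alpha D)) := by
      intro v hv
      rw [mem_ball_zero_iff] at hv ⊢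
      calc ‖(k : ℂ) * I * (alpha D : ℂ) + v‖ ≤ ‖(k : ℂ) * I * (alpha D : ℂ)‖ + ‖v‖ := norm_add_le _ _
        _ < alpha D + alpha D := add_lt_add_of_le_of_lt hpk hv
        _ = 2 * alpha D := by ring
    exact hA.comp (((differentiable_const _).add differentiable_id).differentiableOn) hmaps
  have hgk_eq : (fun v : ℂ => 1 - Pm2w D ((k : ℂ) * I * (alpha D : ℂ) + v)) =
      fun v => 1 - Pm2w D v := funext fun v => by rw [hPer]
  have hgk : DifferentiableOn ℂ (fun v : ℂ => 1 - Pm2w D ((k : ℂ) * I * (alpha D : ℂ) + v))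
      (Metric.ball 0 (alpha D)) := by
    rw [hgk_eq]; exact (differentiable_one_sub_Pm2w D).differentiableOn
  -- Rouché on `|v| = r`
  have hcount := hRouche (fun v => calA χ x (ρ + ((k : ℂ) * I * (alpha D : ℂ) + v)))
    (fun v => 1 - Pm2w D ((k : ℂ) * I * (alpha D : ℂ) + v)) 0 r hr0
    ⟨Metric.ball 0 (alpha D), Metric.isOpen_ball, Metric.closedBall_subset_ball hrα, hfk, hgk⟩
    (fun z hz => by
      rw [mem_sphere_zero_iff_norm] at hz
      have hz2 : ‖(k : ℂ) * I * (alpha D : ℂ) + z‖ < 2 * alpha D := by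
        calc ‖(k : ℂ) * I * (alpha D : ℂ) + z‖ ≤ ‖(k : ℂ) * I * (alpha D : ℂ)‖ + ‖z‖ :=
              norm_add_le _ _
          _ < 2 * alpha D := by rw [hz]; linarith
      have h1 := E412 _ hz2
      have h2 := hbig z hz
      show ‖calA χ x (ρ + ((k : ℂ) * I * (alpha D : ℂ) + z)) -
          (1 - Pm2w D ((k : ℂ) * I * (alpha D : ℂ) + z))‖ <
        ‖1 - Pm2w D ((k : ℂ) * I * (alpha D : ℂ) + z)‖
      rw [hPer] at h1 ⊢
      exact lt_of_le_of_lt h1 h2)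
  -- the count of the comparison function is `1`
  rw [hgk_eq] at hcount
  have hg_an : AnalyticOnNhd ℂ (fun v : ℂ => 1 - Pm2w D v) (Metric.ball 0 r) :=
    (differentiable_one_sub_Pm2w D).differentiableOn.analyticOnNhd Metric.isOpen_ball
  rw [finsum_analyticOrderNatAt_eq_one_of_zeros_eq hg_an eone
    (deriv_one_sub_Pm2w_zero_ne_zero hD2)] at hcount
  have hf_an : AnalyticOnNhd ℂ (fun v : ℂ => calA χ x (ρ + ((k : ℂ) * I * (alpha D : ℂ) + v)))
      (Metric.ball 0 r) :=
    (hfk.mono (Metric.ball_subset_ball hrα.le)).analyticOnNhd Metric.isOpen_ball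
  obtain ⟨v, hv, -⟩ := existsUnique_zero_of_finsum_analyticOrderNatAt_eq_one hf_an hcount
  exact ⟨v, hv⟩

/-- **Assembly: the zero set of `𝒜(ρ+·)` in `|w| < R` is `{0, iα + v₁, −iα + v₋₁}`** — every zero in
the big disc is near a lattice point `ikα`, `|k| ≤ 1`, hence is THE zero of the `k`-th small disc
(for `k = 0`: `ρ` itself); the two outer zeros, within `2ηα` of `±iα`, lie in `|w| < R` once
`α(1 + 2η) < R`. [cite: Zhang2022LandauSiegel, §4 Lemma 4.7] -/
theorem zeros_eq_three {r η R : ℝ} (hα : 0 < alpha D) (hr0 : 0 < r) (hRpos : 0 < R)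
    (hR2α : R < 2 * alpha D) (h2ηr : 2 * η * alpha D < r) (hR2 : R + 2 * η * alpha D ≤ 2 * alpha D)
    (hRin : alpha D + 2 * η * alpha D < R) (hAρ : calA χ x ρ = 0)
    (near : ∀ w : ℂ, ‖w‖ < 2 * alpha D → calA χ x (ρ + w) = 0 →
      ∃ k : ℤ, ‖w - (k : ℂ) * I * (alpha D : ℂ)‖ ≤ 2 * η * alpha D)
    {v₁ v₀ vm : ℂ}
    (hv₁ : {v' : ℂ | ‖v'‖ < r ∧ calA χ x (ρ + (((1 : ℤ) : ℂ) * I * (alpha D : ℂ) + v')) = 0} = {v₁})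
    (hv₀ : {v' : ℂ | ‖v'‖ < r ∧ calA χ x (ρ + (((0 : ℤ) : ℂ) * I * (alpha D : ℂ) + v')) = 0} = {v₀})
    (hvm : {v' : ℂ | ‖v'‖ < r ∧ calA χ x (ρ + (((-1 : ℤ) : ℂ) * I * (alpha D : ℂ) + v')) = 0} = {vm})
    (hv₁n : ‖v₁‖ ≤ 2 * η * alpha D) (hv₁z : calA χ x (ρ + (((1 : ℤ) : ℂ) * I * (alpha D : ℂ) + v₁)) = 0)
    (hvmn : ‖vm‖ ≤ 2 * η * alpha D)
    (hvmz : calA χ x (ρ + (((-1 : ℤ) : ℂ) * I * (alpha D : ℂ) + vm)) = 0) :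
    {w : ℂ | ‖w‖ < R ∧ calA χ x (ρ + w) = 0} =
      {(0 : ℂ), I * (alpha D : ℂ) + v₁, -(I * (alpha D : ℂ)) + vm} := by
  have hnk : ∀ k : ℤ, ‖(k : ℂ) * I * (alpha D : ℂ)‖ = |(k : ℝ)| * alpha D :=
    fun k => norm_int_mul_I_mul_alpha hα.le k
  have e1 : ((1 : ℤ) : ℂ) * I * (alpha D : ℂ) = I * (alpha D : ℂ) := by push_cast; ring
  have em : ((-1 : ℤ) : ℂ) * I * (alpha D : ℂ) = -(I * (alpha D : ℂ)) := by push_cast; ring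
  have hnIα : ‖I * (alpha D : ℂ)‖ = alpha D := by
    rw [norm_mul, Complex.norm_I, one_mul, Complex.norm_real, Real.norm_of_nonneg hα.le]
  -- `v₀ = 0` (`ρ` itself is the zero at the centre)
  have hv₀0 : v₀ = 0 := by
    have : (0 : ℂ) ∈
        {v' : ℂ | ‖v'‖ < r ∧ calA χ x (ρ + (((0 : ℤ) : ℂ) * I * (alpha D : ℂ) + v')) = 0} := by
      refine ⟨by simpa using hr0, ?_⟩
      simpa using hAρ
    rw [hv₀] at this
    exact (Set.mem_singleton_iff.mp this).symm
  ext w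
  simp only [Set.mem_setOf_eq, Set.mem_insert_iff, Set.mem_singleton_iff]
  constructor
  · rintro ⟨hwR, hwz⟩
    obtain ⟨k, hk⟩ := near w (hwR.trans hR2α) hwz
    -- `|k| ≤ 1`
    have hkabs : |k| ≤ 1 := by
      have h1 : |(k : ℝ)| * alpha D < 2 * alpha D := by
        rw [← hnk]
        have := norm_sub_norm_le ((k : ℂ) * I * (alpha D : ℂ)) w
        rw [norm_sub_rev] at hk
        linarith
      have h2 : |(k : ℝ)| < 2 := lt_of_mul_lt_mul_right h1 hα.le
      have h3 : |k| < 2 := by exact_mod_cast h2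
      obtain ⟨h4, h5⟩ := abs_lt.mp h3
      exact abs_le.mpr ⟨by omega, by omega⟩
    -- `w − ikα` is the zero of the `k`-th small disc
    have hvmem : (w - (k : ℂ) * I * (alpha D : ℂ)) ∈
        {v' : ℂ | ‖v'‖ < r ∧ calA χ x (ρ + ((k : ℂ) * I * (alpha D : ℂ) + v')) = 0} := by
      refine ⟨lt_of_le_of_lt hk h2ηr, ?_⟩
      have : (k : ℂ) * I * (alpha D : ℂ) + (w - (k : ℂ) * I * (alpha D : ℂ)) = w := by ring
      rw [this]; exact hwz
    have hwk : ∀ v : ℂ, w - (k : ℂ) * I * (alpha D : ℂ) = v →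
        w = (k : ℂ) * I * (alpha D : ℂ) + v := by
      intro v h; rw [← h]; ring
    obtain ⟨hk1, hk2⟩ := abs_le.mp hkabs
    interval_cases k
    · rw [hvm] at hvmem
      have := hwk _ (Set.mem_singleton_iff.mp hvmem)
      rw [em] at this
      exact Or.inr (Or.inr this)
    · rw [hv₀] at hvmem
      have := hwk _ (Set.mem_singleton_iff.mp hvmem)
      rw [hv₀0] at this
      left; rw [this]; simp
    · rw [hv₁] at hvmem
      have := hwk _ (Set.mem_singleton_iff.mp hvmem)
      rw [e1] at this
      exact Or.inr (Or.inl this)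
  · rintro (rfl | rfl | rfl)
    · exact ⟨by simpa using hRpos, by simpa using hAρ⟩
    · refine ⟨?_, by rw [← e1]; exact hv₁z⟩
      calc ‖I * (alpha D : ℂ) + v₁‖ ≤ ‖I * (alpha D : ℂ)‖ + ‖v₁‖ := norm_add_le _ _
        _ ≤ alpha D + 2 * η * alpha D := by rw [hnIα]; gcongr
        _ < R := hRin
    · refine ⟨?_, by rw [← em]; exact hvmz⟩
      calc ‖-(I * (alpha D : ℂ)) + vm‖ ≤ ‖-(I * (alpha D : ℂ))‖ + ‖vm‖ := norm_add_le _ _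
        _ ≤ alpha D + 2 * η * alpha D := by rw [norm_neg, hnIα]; gcongr
        _ < R := hRin

omit [NeZero D] in
/-- **"exactly three zeros"**: the three located points `0`, `iα + v₁`, `−iα + v₋₁` (`|v_{±1}| < α`)
are pairwise distinct, so a set equal to `{0, iα + v₁, −iα + v₋₁}` has `ncard = 3`.
[cite: Zhang2022LandauSiegel, §4 Lemma 4.7] -/
theorem ncard_three_points (hα : 0 < alpha D) {v₁ vm : ℂ} (hv₁ : ‖v₁‖ < alpha D)
    (hvm : ‖vm‖ < alpha D) :
    ({(0 : ℂ), I * (alpha D : ℂ) + v₁, -(I * (alpha D : ℂ)) + vm} : Set ℂ).ncard = 3 := by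
  have hnIα : ‖I * (alpha D : ℂ)‖ = alpha D := by
    rw [norm_mul, Complex.norm_I, one_mul, Complex.norm_real, Real.norm_of_nonneg hα.le]
  have hne1 : I * (alpha D : ℂ) + v₁ ≠ 0 := by
    intro h
    have hv : v₁ = -(I * (alpha D : ℂ)) := by linear_combination h
    have : ‖v₁‖ = alpha D := by rw [hv, norm_neg, hnIα]
    linarith
  have hnem : -(I * (alpha D : ℂ)) + vm ≠ 0 := by
    intro h
    have hv : vm = I * (alpha D : ℂ) := by linear_combination h
    have : ‖vm‖ = alpha D := by rw [hv, hnIα]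
    linarith
  have hne2 : I * (alpha D : ℂ) + v₁ ≠ -(I * (alpha D : ℂ)) + vm := by
    intro h
    have hv : vm - v₁ = 2 * (I * (alpha D : ℂ)) := by linear_combination (-1 : ℂ) * h
    have h2 : ‖vm - v₁‖ = 2 * alpha D := by
      rw [hv, norm_mul, hnIα]; norm_num
    have h3 : ‖vm - v₁‖ ≤ ‖vm‖ + ‖v₁‖ := norm_sub_le _ _
    linarith
  exact Set.ncard_eq_three.mpr ⟨_, _, _, hne1.symm, hnem.symm, hne2, rfl⟩

end Pieces

/-! ## The edge: the three zeros of Lemma 4.7, and Lemma 4.7, modulo FACT F-29 -/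

variable [NeZero D] (χ : DirichletCharacter ℂ D)

/-- **The three zeros of `𝒜(ρ+w,ψ)` in `|w| < α(1+c′α𝓛)`, LOCATED** (`Z22:Lem4.7.pf`, §4 p. 23, "which
are at `w = 0`, `w = iα` and `w = −iα`" for the comparison function): given the exact-count Rouché
theorem `hRouche` **-- FACT F-29 (hypothesis form)** [Conway 1973, V §3 Thm 3.8], Lemma 4.2 and
(4.12), there is `c₀ = 4C⁺ + 1` such that for every `c′ ≥ c₀`, `D` large, `ψ ∈ Ψ₁` and a zero
`ρ = 1/2 + iγ` of `𝒜(s,ψ)` with `|γ − 2πt₀| < 𝓛₁ + 2`, the zero set of `𝒜(ρ+·,ψ)` in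
`|w| < α(1+c′α𝓛)` is `{0, iα + v₁, −iα + v₋₁}` with `|v_{±1}| < c′α²𝓛`.
[cite: Zhang2022LandauSiegel, §4 Lemma 4.7 (proof)] -/
theorem three_zeros_of_rouche
    -- FACT F-29 (hypothesis form): Rouché's theorem, exact-count form [Conway 1973, V.3.8]
    (hRouche : ∀ (f g : ℂ → ℂ) (c : ℂ) (r : ℝ), 0 < r →
      (∃ U : Set ℂ, IsOpen U ∧ Metric.closedBall c r ⊆ U ∧ DifferentiableOn ℂ f U ∧
        DifferentiableOn ℂ g U) →
      (∀ z ∈ Metric.sphere c r, ‖f z - g z‖ < ‖g z‖) →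
      ∑ᶠ z ∈ Metric.ball c r, analyticOrderNatAt f z =
        ∑ᶠ z ∈ Metric.ball c r, analyticOrderNatAt g z)
    (h42 : Lemma42) (h412 : Eq412) : ∃ c₀ : ℝ, ∀ c' : ℝ, c₀ ≤ c' →
      ForAllLarge fun D _ χ => ∀ x ∈ PsiOne χ, ∀ ρ : ℂ, calA χ x ρ = 0 → ρ.re = 1 / 2 →
        |ρ.im - 2 * π * t0 D| < ell1 D + 2 →
          ∃ v₁ vm : ℂ, ‖v₁‖ < c' * alpha D ^ 2 * ell D ∧ ‖vm‖ < c' * alpha D ^ 2 * ell D ∧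
            {w : ℂ | ‖w‖ < alpha D * (1 + c' * alpha D * ell D) ∧ calA χ x (ρ + w) = 0} =
              {(0 : ℂ), I * (alpha D : ℂ) + v₁, -(I * (alpha D : ℂ)) + vm} := by
  obtain ⟨C₂, h42⟩ := h42
  obtain ⟨C, h412⟩ := h412
  set Cp : ℝ := max C 0 with hCp
  have hCp0 : 0 ≤ Cp := le_max_right _ _
  have hCCp : C ≤ Cp := le_max_left _ _
  refine ⟨4 * Cp + 1, fun c' hc' => ?_⟩
  have hc'pos : 0 < c' := by linarith
  obtain ⟨D₁, hD₁, hδD⟩ := exists_delta_le c' (1 / 200) (by norm_num)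
  obtain ⟨D₂, hD₂, hηD⟩ := exists_delta_le Cp (1 / 8) (by norm_num)
  have h413 : Eq413 c' := eq413_of_pos hc'pos
  have hone : OneSubPwOneZero c' := oneSubPwOneZero_of_nonneg hc'pos.le
  obtain ⟨D₀, hD₀⟩ := ((h42.and h412).and h413).and hone
  refine ⟨max (max D₀ (max D₁ D₂)) (max 3 ⌈Real.exp (max 3 (2 * C₂))⌉₊),
    fun D _ χ hD hq hp x hx ρ hAρ hre hγ => ?_⟩
  have hDD₀ : D₀ ≤ D := le_trans (le_trans (le_max_left _ _) (le_max_left _ _)) hD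
  have hD' : max D₁ D₂ ≤ D := le_trans (le_trans (le_max_right _ _) (le_max_left _ _)) hD
  have hDD₁ : D₁ ≤ D := le_trans (le_max_left _ _) hD'
  have hDD₂ : D₂ ≤ D := le_trans (le_max_right _ _) hD'
  have hD3 : 3 ≤ D := le_trans (le_trans (le_max_left _ _) (le_max_right _ _)) hD
  have hDe : ⌈Real.exp (max 3 (2 * C₂))⌉₊ ≤ D :=
    le_trans (le_trans (le_max_right _ _) (le_max_right _ _)) hD
  obtain ⟨hℓ3, hℓC⟩ := max_le_iff.mp (le_ell_of_ceil_exp_le hDe)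
  have hℓ0 : 0 < ell D := by linarith
  have hD2 : 2 ≤ D := by omega
  obtain ⟨⟨⟨e42, e412⟩, e413⟩, eone⟩ := hD₀ D χ hDD₀ hq hp
  -- the parameters `α`, `δ = c′α𝓛`, `η = C⁺α𝓛`, radii `r = α(1−δ) < α < R = α(1+δ) < 2α`
  have hα : 0 < alpha D := by
    rw [Section2.alpha_eq_pi_div_ell9]; exact div_pos Real.pi_pos (pow_pos hℓ0 9)
  have hαℓ : 0 < alpha D * ell D := mul_pos hα hℓ0
  set δ : ℝ := c' * alpha D * ell D with hδ
  set η : ℝ := Cp * alpha D * ell D with hη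
  have hδ0 : 0 < δ := by rw [hδ, mul_assoc]; exact mul_pos hc'pos hαℓ
  have hδ1 : δ ≤ 1 / 200 := hδD D hDD₁
  have hη0 : 0 ≤ η := by rw [hη, mul_assoc]; exact mul_nonneg hCp0 hαℓ.le
  have hη1 : η ≤ 1 / 8 := hηD D hDD₂
  have h2ηδ : 2 * η < δ := by
    rw [hη, hδ, mul_assoc, mul_assoc]; nlinarith
  set r : ℝ := alpha D * (1 - δ) with hr
  set R : ℝ := alpha D * (1 + δ) with hR
  have hr0 : 0 < r := by rw [hr]; exact mul_pos hα (by linarith)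
  have hrα : r < alpha D := by rw [hr]; nlinarith
  have hR2α : R < 2 * alpha D := by rw [hR]; nlinarith
  have hRpos : 0 < R := by rw [hR]; positivity
  -- `ρ = 1/2 + iγ` is in Lemma 4.6's region
  have hρeq : (1 / 2 : ℂ) + (ρ.im : ℂ) * I = ρ := by
    apply Complex.ext <;> simp [hre]
  have hρ46 : ρ ∈ lemma46Region D := by
    refine ⟨by rw [hre], ?_, hγ⟩
    rw [hre]; have := pow_pos hα 2; linarith
  -- `𝒜(ρ + ·)` is holomorphic on `|w| < 2α`
  have hA : DifferentiableOn ℂ (fun w : ℂ => calA χ x (ρ + w)) (Metric.ball 0 (2 * alpha D)) := by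
    have h := differentiableOn_calA_shift χ hD3 hp hℓ3 hℓC x (e42 x hx) hγ
    simpa only [hρeq] using h
  -- (4.12) around `ρ`: `|𝒜(ρ+w) − (1 − P^{−2w})| ≤ η` for `|w| < 2α`
  have E412 : ∀ w : ℂ, ‖w‖ < 2 * alpha D → ‖calA χ x (ρ + w) - (1 - Pm2w D w)‖ ≤ η := by
    intro w hw
    have h := e412 x hx ρ hρ46 hAρ w hw
    rw [hρeq] at h
    refine h.trans ?_
    rw [hη, mul_assoc]
    exact mul_le_mul_of_nonneg_right hCCp hαℓ.le
  -- (4.13) on `|z| = r`: `|1 − P^{−2z}| > 6δ > η`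
  have hbig : ∀ z : ℂ, ‖z‖ = r → η < ‖1 - Pm2w D z‖ := by
    intro z hz
    have h2 : 6 * c' * alpha D * ell D < ‖1 - Pm2w D z‖ := e413 z hz
    have h3 : 6 * c' * alpha D * ell D = 6 * δ := by rw [hδ]; ring
    linarith
  have near : ∀ w : ℂ, ‖w‖ < 2 * alpha D → calA χ x (ρ + w) = 0 →
      ∃ k : ℤ, ‖w - (k : ℂ) * I * (alpha D : ℂ)‖ ≤ 2 * η * alpha D :=
    fun w hw hz => zero_near_lattice χ x ρ hℓ0 hα hη1 E412 hw hz
  have key : ∀ k : ℤ, |k| ≤ 1 →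
      ∃ v : ℂ, {v' : ℂ | ‖v'‖ < r ∧ calA χ x (ρ + ((k : ℂ) * I * (alpha D : ℂ) + v')) = 0} = {v} :=
    fun k hk => small_disc_unique_zero χ x ρ hRouche hℓ0 hD2 hα hr0 hrα hA E412 hbig eone hk
  obtain ⟨v₁, hv₁⟩ := key 1 (by norm_num)
  obtain ⟨v₀, hv₀⟩ := key 0 (by norm_num)
  obtain ⟨vm, hvm⟩ := key (-1) (by norm_num)
  have hsum : 2 * η * alpha D + r ≤ alpha D := by rw [hr]; nlinarith
  obtain ⟨hv₁n, hv₁z⟩ := small_disc_zero_norm_le χ x ρ hα hrα hsum near (by norm_num) hv₁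
  obtain ⟨hvmn, hvmz⟩ := small_disc_zero_norm_le χ x ρ hα hrα hsum near (by norm_num) hvm
  have h2ηr : 2 * η * alpha D < r := by
    rw [hr]; nlinarith [mul_pos hα (show (0:ℝ) < 1 - δ - 2 * η by linarith)]
  have hR2 : R + 2 * η * alpha D ≤ 2 * alpha D := by rw [hR]; nlinarith
  have hRin : alpha D + 2 * η * alpha D < R := by rw [hR]; nlinarith
  have hbound : 2 * η * alpha D < c' * alpha D ^ 2 * ell D := by
    have : c' * alpha D ^ 2 * ell D = δ * alpha D := by rw [hδ]; ring
    rw [this]; nlinarith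
  exact ⟨v₁, vm, lt_of_le_of_lt hv₁n hbound, lt_of_le_of_lt hvmn hbound,
    zeros_eq_three χ x ρ hα hr0 hRpos hR2α h2ηr hR2 hRin hAρ near hv₁ hv₀ hvm hv₁n hv₁z hvmn hvmz⟩

/-- **Lemma 4.7 from (4.12), modulo Rouché** (`Z22:Lem4.7` + `Z22:Lem4.7.pf`, §4 p. 23): given the
exact-count Rouché theorem `hRouche` **-- FACT F-29 (hypothesis form)** [Conway 1973, V §3 Thm 3.8],
Lemma 4.2 and (4.12), for every sufficiently large `c′` and `D` large, `ψ ∈ Ψ₁` and a zero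
`ρ = 1/2 + iγ` of `𝒜(s,ψ)` with `|γ − 2πt₀| < 𝓛₁ + 2`, `𝒜(ρ+w,ψ)` has exactly three (distinct,
simple) zeros in `|w| < α(1+c′α𝓛)` — the node `Skeleton.Lemma47 c′` (`three_zeros_of_rouche` +
`ncard_three_points`; `c′α²𝓛 < α` for `D` large). [cite: Zhang2022LandauSiegel, §4 Lemma 4.7] -/
theorem lemma47_of_rouche
    -- FACT F-29 (hypothesis form): Rouché's theorem, exact-count form [Conway 1973, V.3.8]
    (hRouche : ∀ (f g : ℂ → ℂ) (c : ℂ) (r : ℝ), 0 < r →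
      (∃ U : Set ℂ, IsOpen U ∧ Metric.closedBall c r ⊆ U ∧ DifferentiableOn ℂ f U ∧
        DifferentiableOn ℂ g U) →
      (∀ z ∈ Metric.sphere c r, ‖f z - g z‖ < ‖g z‖) →
      ∑ᶠ z ∈ Metric.ball c r, analyticOrderNatAt f z =
        ∑ᶠ z ∈ Metric.ball c r, analyticOrderNatAt g z)
    (h42 : Lemma42) (h412 : Eq412) : ∃ c₀ : ℝ, ∀ c' : ℝ, c₀ ≤ c' → Lemma47 c' := by
  obtain ⟨c₀, h3⟩ := three_zeros_of_rouche hRouche h42 h412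
  refine ⟨c₀, fun c' hc' => ?_⟩
  obtain ⟨D₁, hD₁, hδD⟩ := exists_delta_le c' (1 / 200) (by norm_num)
  obtain ⟨D₀, hD₀⟩ := h3 c' hc'
  refine ⟨max D₀ D₁, fun D _ χ hD hq hp x hx ρ hAρ hre hγ => ?_⟩
  have hDD₀ : D₀ ≤ D := le_trans (le_max_left _ _) hD
  have hDD₁ : D₁ ≤ D := le_trans (le_max_right _ _) hD
  have hD2 : 2 ≤ D := le_trans hD₁ hDD₁
  have hℓ0 : 0 < ell D := Real.log_pos (by exact_mod_cast hD2)
  have hα : 0 < alpha D := by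
    rw [Section2.alpha_eq_pi_div_ell9]; exact div_pos Real.pi_pos (pow_pos hℓ0 9)
  obtain ⟨v₁, vm, hv₁, hvm, hset⟩ := hD₀ D χ hDD₀ hq hp x hx ρ hAρ hre hγ
  -- `c′α²𝓛 = (c′α𝓛)·α ≤ α/200 < α`
  have hsmall : c' * alpha D ^ 2 * ell D < alpha D := by
    have hδ := hδD D hDD₁
    have : c' * alpha D ^ 2 * ell D = (c' * alpha D * ell D) * alpha D := by ring
    rw [this]; nlinarith
  rw [hset]
  exact ncard_three_points hα (hv₁.trans hsmall) (hvm.trans hsmall)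

end Literature.NumberTheory.LFunctions.Zhang2022.Section4
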